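import Literature.Probability.LatticeModels.LeeYangProofs
import HarnessLib

/-!
# The Lee–Yang theorem with site-dependent radii (Ruelle's form of the Asano contraction)

Topic `Probability/LatticeModels`, namespace `Literature.Probability.LatticeModels.LeeYangRadii`;
continues `LeeYangProofs.lean` (namespace `LeeYangCircle`: the classical theorem, all fugacities
in the OPEN UNIT polydisc). Ruelle's extension of the Lee–Yang circle theorem (Ruelle 1971;
Ruelle 1973, Lemma 4.2 / Prop. 4.4: "Let `A`, `B` be closed subsets of `ℂ` not containing `0`;
if `α + βu + γv + δuv ≠ 0` whenever `u ∉ A`, `v ∉ B`, then `α + δw ≠ 0` whenever `w ∉ -AB`")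
replaces the unit discs by arbitrary regions which MULTIPLY under contraction. We formalise the
disc case with arbitrary radii, which is what a non-uniform zero-free region needs:

* `asano_contraction_radii` — zero-free on `‖ζ‖ < ρ₁`, `‖η‖ < ρ₂` implies the contraction is
  zero-free on `‖ζ‖ < ρ₁ρ₂` (Ruelle's lemma for `A = {|u| ≥ ρ₁}`, `B = {|v| ≥ ρ₂}`; by rescaling
  from `LeeYangCircle.asano_contraction`).
* `boost t r = √(1 + (1-t²)(1-r²)/(t+r)²)` and `edge_ne_zero_radii` — the one-edge polynomial
  `1 + tu + tv + uv` (`t = e^{-2J} ∈ [0,1]`) has no zero with `‖u‖ < r ≤ 1`, `‖v‖ < boost t r`: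
  a zero has `v = -(1+tu)/(t+u)`, and `|1+tu|² - |t+u|² = (1-t²)(1-|u|²)` gives
  `|v|² ≥ 1 + (1-t²)(1-r²)/(t+r)²`. So shrinking the disc at one end of a ferromagnetic edge
  (`r < 1`) ENLARGES it at the other end beyond the unit circle (`boost t r > 1` for `t < 1`) —
  the mechanism by which a strong field at some sites certifies zero-freeness at field-free
  neighbours (`1 ≤ boost`, `one_lt_boost`, `boost_le_inv : boost t r ≤ r⁻¹`).
* `asano_edge_radii`, `zeroFree_mul_edge` — gluing one edge multiplies the radius at its two
  ends by `r` and `boost t r` (the induction step of `LeeYangCircle.lyProp_mul_edge` with radii).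
* `radii`, `edgeWeight`, `zeroFree_prod_edges` — for a finite set `E` of ORIENTED edges
  `(i, j, r)` (`i ≠ j`, `0 < r ≤ 1`: the end `i` pays the factor `r`, the end `j` gains
  `boost t r`), the multi-affine polynomial `∑_σ (∏_{e∈E} [σ_i = σ_j ? 1 : t]) ∏ₖ [σₖ ? 1 : zₖ]`
  has no zero with `‖zₖ‖ < radii t E k = ∏_{e ∈ E} (factor of e at k)` (`radii_eq`: the product of
  the `r`'s of the edges leaving `k` and the boosts of the edges entering `k`).

Used by `Literature/Barriers/CriticalPhenomena/PositionSpaceRGNonGibbsianTypes.lean` (uniform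
zero-free disc for the internal-spin system of the `b = 2` decimation, van Enter–Fernández–Sokal
1993 §4.3.1 Step 2.2, at ALL temperatures). No named facts; everything is proved.

## References

* D. Ruelle, *Extension of the Lee–Yang circle theorem*, Phys. Rev. Lett. 26 (1971) 303–304.
* D. Ruelle, *Some remarks on the location of zeroes of the partition function for lattice
  systems*, Comm. Math. Phys. 31 (1973) 265–277, §4.
* T. D. Lee, C. N. Yang, Phys. Rev. 87 (1952) 410–419, Appendix II [LeeYang1952].
* S. Friedli, Y. Velenik, *Statistical Mechanics of Lattice Systems* (CUP 2017), §3.7.4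
  [FriedliVelenik2017].
-/

noncomputable section

open scoped BigOperators

namespace Literature.Probability.LatticeModels

namespace LeeYangRadii

open LeeYangCircle

/-! ### Step 1: the contraction lemma with radii -/

/-- **Asano–Ruelle contraction with radii.** If `a + bζ + cη + dζη ≠ 0` whenever `‖ζ‖ < ρ₁` and
`‖η‖ < ρ₂` (`ρ₁, ρ₂ > 0`), then `a + dζ ≠ 0` whenever `‖ζ‖ < ρ₁ρ₂` (Ruelle's lemma with the closed
sets `A = {|u| ≥ ρ₁}`, `B = {|v| ≥ ρ₂}`, `-AB = {|w| ≥ ρ₁ρ₂}`; here by rescaling the variables in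
`LeeYangCircle.asano_contraction`). [cite: LeeYang1952, Appendix II] -/
theorem asano_contraction_radii {a b c d : ℂ} {ρ₁ ρ₂ : ℝ} (hρ₁ : 0 < ρ₁) (hρ₂ : 0 < ρ₂)
    (H : ∀ ζ η : ℂ, ‖ζ‖ < ρ₁ → ‖η‖ < ρ₂ → a + b * ζ + c * η + d * ζ * η ≠ 0) :
    ∀ ζ : ℂ, ‖ζ‖ < ρ₁ * ρ₂ → a + d * ζ ≠ 0 := by
  have H' : ∀ ζ η : ℂ, ‖ζ‖ < 1 → ‖η‖ < 1 →
      a + (b * ρ₁) * ζ + (c * ρ₂) * η + (d * (ρ₁ * ρ₂)) * ζ * η ≠ 0 := by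
    intro ζ η hζ hη
    have h1 : ‖(ρ₁ : ℂ) * ζ‖ < ρ₁ := by
      rw [norm_mul, Complex.norm_of_nonneg hρ₁.le]
      calc ρ₁ * ‖ζ‖ < ρ₁ * 1 := mul_lt_mul_of_pos_left hζ hρ₁
        _ = ρ₁ := mul_one _
    have h2 : ‖(ρ₂ : ℂ) * η‖ < ρ₂ := by
      rw [norm_mul, Complex.norm_of_nonneg hρ₂.le]
      calc ρ₂ * ‖η‖ < ρ₂ * 1 := mul_lt_mul_of_pos_left hη hρ₂
        _ = ρ₂ := mul_one _
    have := H _ _ h1 h2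
    convert this using 1
    ring
  intro ζ hζ
  have hpos : 0 < ρ₁ * ρ₂ := mul_pos hρ₁ hρ₂
  have hζ' : ‖ζ / ((ρ₁ * ρ₂ : ℝ) : ℂ)‖ < 1 := by
    rw [norm_div, Complex.norm_of_nonneg hpos.le, div_lt_one hpos]
    exact hζ
  have key := asano_contraction H' (ζ / ((ρ₁ * ρ₂ : ℝ) : ℂ)) hζ'
  have e : a + d * (ρ₁ * ρ₂) * (ζ / ((ρ₁ * ρ₂ : ℝ) : ℂ)) = a + d * ζ := by
    have h12 : ((ρ₁ : ℂ) * ρ₂) ≠ 0 := by exact_mod_cast hpos.ne'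
    push_cast
    congr 1
    rw [mul_assoc, mul_div_assoc', mul_div_cancel_left₀ ζ h12]
  rwa [e] at key

/-! ### Step 2: the boosted edge lemma -/

/-- **The boost factor** of a ferromagnetic edge with parameter `t = e^{-2J} ∈ [0,1]` whose first
end is confined to the disc of radius `r ≤ 1`: `boost t r = √(1 + (1-t²)(1-r²)/(t+r)²)`, the
radius of the zero-free disc at the other end (`edge_ne_zero_radii`). [cite: LeeYang1952, Appendix II] -/
def boost (t r : ℝ) : ℝ := Real.sqrt (1 + (1 - t ^ 2) * (1 - r ^ 2) / (t + r) ^ 2)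

/-- The quantity under the square root minus one is nonnegative. [folklore] -/
theorem boost_aux_nonneg {t r : ℝ} (ht0 : 0 ≤ t) (ht1 : t ≤ 1) (hr0 : 0 < r) (hr1 : r ≤ 1) :
    0 ≤ (1 - t ^ 2) * (1 - r ^ 2) / (t + r) ^ 2 :=
  div_nonneg (mul_nonneg (by nlinarith) (by nlinarith)) (sq_nonneg _)

/-- `boost t r ≥ 0`. [folklore] -/
theorem boost_nonneg (t r : ℝ) : 0 ≤ boost t r := Real.sqrt_nonneg _

/-- `(boost t r)² = 1 + (1-t²)(1-r²)/(t+r)²`. [folklore] -/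
theorem boost_sq {t r : ℝ} (ht0 : 0 ≤ t) (ht1 : t ≤ 1) (hr0 : 0 < r) (hr1 : r ≤ 1) :
    boost t r ^ 2 = 1 + (1 - t ^ 2) * (1 - r ^ 2) / (t + r) ^ 2 :=
  Real.sq_sqrt (by linarith [boost_aux_nonneg ht0 ht1 hr0 hr1])

/-- `1 ≤ boost t r`. [folklore] -/
theorem one_le_boost {t r : ℝ} (ht0 : 0 ≤ t) (ht1 : t ≤ 1) (hr0 : 0 < r) (hr1 : r ≤ 1) :
    1 ≤ boost t r := by
  calc (1 : ℝ) = Real.sqrt 1 := Real.sqrt_one.symm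
    _ ≤ boost t r := Real.sqrt_le_sqrt (by linarith [boost_aux_nonneg ht0 ht1 hr0 hr1])

/-- `0 < boost t r`. [folklore] -/
theorem boost_pos {t r : ℝ} (ht0 : 0 ≤ t) (ht1 : t ≤ 1) (hr0 : 0 < r) (hr1 : r ≤ 1) :
    0 < boost t r :=
  lt_of_lt_of_le one_pos (one_le_boost ht0 ht1 hr0 hr1)

/-- **Strict boost**: for `t < 1` and `r < 1` the other end's disc is strictly larger than the unit
disc, `1 < boost t r`. [folklore] -/
theorem one_lt_boost {t r : ℝ} (ht0 : 0 ≤ t) (ht1 : t < 1) (hr0 : 0 < r) (hr1 : r < 1) :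
    1 < boost t r := by
  have hpos : 0 < (1 - t ^ 2) * (1 - r ^ 2) / (t + r) ^ 2 :=
    div_pos (mul_pos (by nlinarith) (by nlinarith)) (by positivity)
  calc (1 : ℝ) = Real.sqrt 1 := Real.sqrt_one.symm
    _ < boost t r := Real.sqrt_lt_sqrt zero_le_one (by linarith)

/-- `boost t r ≤ r⁻¹` (so that a fugacity factor `t ≤ r` compensates a lost boost:
`t · boost t r ≤ 1`). [folklore] -/
theorem boost_le_inv {t r : ℝ} (ht0 : 0 ≤ t) (hr0 : 0 < r) (hr1 : r ≤ 1) :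
    boost t r ≤ r⁻¹ := by
  have h1 : 0 ≤ 1 - r ^ 2 := by nlinarith
  have hr : r ≠ 0 := hr0.ne'
  have key : 1 + (1 - t ^ 2) * (1 - r ^ 2) / (t + r) ^ 2 ≤ (r⁻¹) ^ 2 := by
    have htr : 0 < (t + r) ^ 2 := by positivity
    have hX : (1 - t ^ 2) * (1 - r ^ 2) / (t + r) ^ 2 ≤ (1 - r ^ 2) / r ^ 2 := by
      rw [div_le_div_iff₀ htr (by positivity)]
      nlinarith [mul_nonneg h1 (by positivity : (0 : ℝ) ≤ t ^ 2 + 2 * t * r + t ^ 2 * r ^ 2)]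
    have hr2 : (r⁻¹) ^ 2 = 1 + (1 - r ^ 2) / r ^ 2 := by
      field_simp
      ring
    rw [hr2]
    linarith
  calc boost t r ≤ Real.sqrt ((r⁻¹) ^ 2) := Real.sqrt_le_sqrt key
    _ = r⁻¹ := Real.sqrt_sq (inv_nonneg.2 hr0.le)

/-- `t · boost t r ≤ 1` when `t ≤ r`. [folklore] -/
theorem mul_boost_le_one {t r : ℝ} (ht0 : 0 ≤ t) (hr0 : 0 < r) (hr1 : r ≤ 1)
    (htr : t ≤ r) : t * boost t r ≤ 1 := by
  calc t * boost t r ≤ t * r⁻¹ := mul_le_mul_of_nonneg_left (boost_le_inv ht0 hr0 hr1) ht0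
    _ ≤ r * r⁻¹ := mul_le_mul_of_nonneg_right htr (inv_nonneg.2 hr0.le)
    _ = 1 := mul_inv_cancel₀ hr0.ne'

/-- **The boosted single-edge lemma.** For `t ∈ [0,1]`, `0 < r ≤ 1`, the one-edge Lee–Yang
polynomial `1 + tu + tv + uv` has no zero with `‖u‖ < r` and `‖v‖ < boost t r`: a zero has
`(t+u)v = -(1+tu)` and `|1+tu|² - |t+u|² = (1-t²)(1-|u|²) ≥ (1-t²)(1-r²)`, while `|t+u| < t+r`,
whence `|v|² ≥ 1 + (1-t²)(1-r²)/(t+r)² = (boost t r)²`. (For `r = 1` this is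
`LeeYangCircle.edge_ne_zero`.) [cite: FriedliVelenik2017, §3.7.4, proof of Thm 3.43 (single edge), Exercise 3.27] -/
theorem edge_ne_zero_radii {t : ℝ} (ht0 : 0 ≤ t) (ht1 : t ≤ 1) {r : ℝ} (hr0 : 0 < r) (hr1 : r ≤ 1)
    {u v : ℂ} (hu : ‖u‖ < r) (hv : ‖v‖ < boost t r) : 1 + t * u + t * v + u * v ≠ 0 := by
  intro h0
  have hid : ‖1 + (t : ℂ) * u‖ ^ 2 - ‖(t : ℂ) + u‖ ^ 2 = (1 - t ^ 2) * (1 - ‖u‖ ^ 2) := by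
    simp only [Complex.sq_norm, Complex.normSq_apply, Complex.add_re, Complex.add_im,
      Complex.mul_re, Complex.mul_im, Complex.ofReal_re, Complex.ofReal_im, Complex.one_re,
      Complex.one_im]
    ring
  have h1 : 1 + (t : ℂ) * u = -((t + u) * v) := by linear_combination h0
  have hn : ‖1 + (t : ℂ) * u‖ = ‖(t : ℂ) + u‖ * ‖v‖ := by rw [h1, norm_neg, norm_mul]
  by_cases htu : ‖(t : ℂ) + u‖ = 0
  · have h2 : 1 + (t : ℂ) * u = 0 := by
      rw [← norm_eq_zero, hn, htu, zero_mul]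
    have h3 : ‖(t : ℂ) * u‖ = 1 := by
      have e : (t : ℂ) * u = -1 := by linear_combination h2
      rw [e, norm_neg, norm_one]
    rw [norm_mul, Complex.norm_of_nonneg ht0] at h3
    nlinarith [norm_nonneg u, mul_le_mul_of_nonneg_right ht1 (norm_nonneg u)]
  · have hpos : 0 < ‖(t : ℂ) + u‖ := lt_of_le_of_ne (norm_nonneg _) (Ne.symm htu)
    have hB := boost_sq ht0 ht1 hr0 hr1
    have hv2 : ‖v‖ ^ 2 < boost t r ^ 2 :=
      pow_lt_pow_left₀ hv (norm_nonneg v) two_ne_zero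
    have hlt : ‖1 + (t : ℂ) * u‖ ^ 2 < ‖(t : ℂ) + u‖ ^ 2 * boost t r ^ 2 := by
      rw [hn, mul_pow]
      exact mul_lt_mul_of_pos_left hv2 (by positivity)
    have htu_le : ‖(t : ℂ) + u‖ ≤ t + ‖u‖ := by
      calc ‖(t : ℂ) + u‖ ≤ ‖(t : ℂ)‖ + ‖u‖ := norm_add_le _ _
        _ = t + ‖u‖ := by rw [Complex.norm_of_nonneg ht0]
    have htu_lt : ‖(t : ℂ) + u‖ ^ 2 < (t + r) ^ 2 := by
      have : ‖(t : ℂ) + u‖ < t + r := by linarith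
      exact pow_lt_pow_left₀ this (norm_nonneg _) two_ne_zero
    set N := ‖(t : ℂ) + u‖ ^ 2 with hN
    have htr : 0 < (t + r) ^ 2 := by positivity
    have hK : 0 ≤ (1 - t ^ 2) * (1 - r ^ 2) := mul_nonneg (by nlinarith) (by nlinarith)
    have hX : N * ((1 - t ^ 2) * (1 - r ^ 2) / (t + r) ^ 2) ≤ (1 - t ^ 2) * (1 - r ^ 2) := by
      calc N * ((1 - t ^ 2) * (1 - r ^ 2) / (t + r) ^ 2)
          = (1 - t ^ 2) * (1 - r ^ 2) * (N / (t + r) ^ 2) := by ring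
        _ ≤ (1 - t ^ 2) * (1 - r ^ 2) * 1 := by
            refine mul_le_mul_of_nonneg_left ?_ hK
            rw [div_le_one htr]
            exact htu_lt.le
        _ = (1 - t ^ 2) * (1 - r ^ 2) := mul_one _
    have hL : (1 - t ^ 2) * (1 - r ^ 2) ≤ (1 - t ^ 2) * (1 - ‖u‖ ^ 2) :=
      mul_le_mul_of_nonneg_left (by nlinarith [norm_nonneg u]) (by nlinarith)
    have hE : ‖1 + (t : ℂ) * u‖ ^ 2 = N + (1 - t ^ 2) * (1 - ‖u‖ ^ 2) := by
      rw [hN]; linarith [hid]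
    rw [hB, hE] at hlt
    nlinarith [hlt, hX, hL]

/-- **Two boosted Asano contractions with an edge.** If `a + bζ + cη + dζη ≠ 0` for `‖ζ‖ < ρ₁`,
`‖η‖ < ρ₂`, then for `t ∈ [0,1]`, `0 < r ≤ 1` also `a + tbζ + tcη + dζη ≠ 0` for `‖ζ‖ < ρ₁r`,
`‖η‖ < ρ₂ · boost t r`: multiply by the edge polynomial `1 + tu + tv + uv` in fresh variables
(zero-free for `‖u‖ < r`, `‖v‖ < boost t r`) and contract `ζ ~ u` (radii `ρ₁`, `r`), then `η ~ v`
(radii `ρ₂`, `boost t r`). [cite: FriedliVelenik2017, §3.7.4, proof of Thm 3.43, Cases 2–3] -/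
theorem asano_edge_radii {a b c d : ℂ} {t : ℝ} (ht0 : 0 ≤ t) (ht1 : t ≤ 1) {r : ℝ} (hr0 : 0 < r)
    (hr1 : r ≤ 1) {ρ₁ ρ₂ : ℝ} (hρ₁ : 0 < ρ₁) (hρ₂ : 0 < ρ₂)
    (H : ∀ ζ η : ℂ, ‖ζ‖ < ρ₁ → ‖η‖ < ρ₂ → a + b * ζ + c * η + d * ζ * η ≠ 0) :
    ∀ ζ η : ℂ, ‖ζ‖ < ρ₁ * r → ‖η‖ < ρ₂ * boost t r →
      a + t * b * ζ + t * c * η + d * ζ * η ≠ 0 := by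
  have hb := boost_pos ht0 ht1 hr0 hr1
  -- first contraction `ζ ~ u` (with `η`, `v` frozen)
  have step1 : ∀ η v : ℂ, ‖η‖ < ρ₂ → ‖v‖ < boost t r → ∀ ζ : ℂ, ‖ζ‖ < ρ₁ * r →
      (a + c * η) * (1 + t * v) + (b + d * η) * (t + v) * ζ ≠ 0 := by
    intro η v hη hv
    have := asano_contraction_radii (a := (a + c * η) * (1 + t * v)) (b := (b + d * η) * (1 + t * v))
      (c := (a + c * η) * (t + v)) (d := (b + d * η) * (t + v)) hρ₁ hr0 ?_
    · intro ζ hζ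
      have h := this ζ hζ
      convert h using 1
    · intro ζ u hζ hu
      have hP := H ζ η hζ hη
      have hE := edge_ne_zero_radii ht0 ht1 hr0 hr1 hu hv
      have : (a + c * η) * (1 + ↑t * v) + (b + d * η) * (1 + ↑t * v) * ζ +
          (a + c * η) * (↑t + v) * u + (b + d * η) * (↑t + v) * ζ * u =
          (a + b * ζ + c * η + d * ζ * η) * (1 + t * u + t * v + u * v) := by ring
      rw [this]
      exact mul_ne_zero hP hE
  -- second contraction `η ~ v` (with `ζ` frozen)
  intro ζ η hζ hη
  have := asano_contraction_radii (a := a + t * b * ζ) (b := c + d * t * ζ) (c := a * t + b * ζ)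
    (d := c * t + d * ζ) hρ₂ hb ?_
  · have h := this η hη
    convert h using 1
    ring
  · intro η' v hη' hv
    have h := step1 η' v hη' hv ζ hζ
    convert h using 1
    ring

/-! ### Step 3: edge addition and edge sets with radii -/

variable {ι : Type*} [Fintype ι] [DecidableEq ι]

/-- **Edge addition with radii** (induction step). If the polynomial
`∑_σ w σ ∏ₖ [σₖ ? 1 : zₖ]` of the weight `w` has no zero with `‖zₖ‖ < Rₖ` (`Rₖ > 0`), then the
polynomial of `w · [σ i = σ j ? 1 : t]` (`i ≠ j`, `t ∈ [0,1]`) has no zero with `‖zₖ‖ < R'ₖ`,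
where `R'ᵢ = Rᵢ r`, `R'ⱼ = Rⱼ · boost t r` and `R'ₖ = Rₖ` otherwise (`0 < r ≤ 1`): freeze all
variables but `zᵢ, zⱼ`, write the polynomial as `a + bzᵢ + czⱼ + dzᵢzⱼ`
(`LeeYangCircle.exists_biaffine_repr`), the new one as `a + tbzᵢ + tczⱼ + dzᵢzⱼ`
(`LeeYangCircle.sum_mul_edge`, `sum_mul_spin`) and use `asano_edge_radii`.
[cite: FriedliVelenik2017, §3.7.4, proof of Thm 3.43 (induction on |E|), Rem. 3.45] -/
theorem zeroFree_mul_edge {w : (ι → Bool) → ℂ} {R : ι → ℝ} (hR : ∀ k, 0 < R k)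
    (hw : ∀ z : ι → ℂ, (∀ k, ‖z k‖ < R k) →
      (∑ σ : ι → Bool, w σ * ∏ k, (if σ k then (1 : ℂ) else z k)) ≠ 0)
    {i j : ι} (hij : i ≠ j) {t : ℝ} (ht0 : 0 ≤ t) (ht1 : t ≤ 1) {r : ℝ} (hr0 : 0 < r) (hr1 : r ≤ 1) :
    ∀ z : ι → ℂ,
      (∀ k, ‖z k‖ < Function.update (Function.update R i (R i * r)) j (R j * boost t r) k) →
      (∑ σ : ι → Bool, w σ * (if σ i = σ j then 1 else (t : ℂ)) *
        ∏ k, (if σ k then (1 : ℂ) else z k)) ≠ 0 := by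
  intro z hz
  set F : ℂ → ℂ → ℂ := fun ζ η => ∑ σ : ι → Bool,
    w σ * ∏ k, (if σ k then (1 : ℂ) else Function.update (Function.update z i ζ) j η k) with hF
  have hF1 : ∀ η, ∃ α β : ℂ, ∀ ζ, F ζ η = α + β * ζ := by
    intro η
    simp only [hF, Function.update_comm hij]
    exact exists_affine_update w _ i
  have hF2 : ∀ ζ, ∃ α β : ℂ, ∀ η, F ζ η = α + β * η := fun ζ => exists_affine_update w _ j
  obtain ⟨a, b, c, d, habcd⟩ := exists_biaffine_repr hF1 hF2
  have HF : ∀ ζ η : ℂ, ‖ζ‖ < R i → ‖η‖ < R j → a + b * ζ + c * η + d * ζ * η ≠ 0 := by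
    intro ζ η hζ hη
    rw [← habcd]
    refine hw _ fun k => ?_
    rcases eq_or_ne k j with rfl | hkj
    · simpa using hη
    rw [Function.update_of_ne hkj]
    rcases eq_or_ne k i with rfl | hki
    · simpa using hζ
    rw [Function.update_of_ne hki]
    have := hz k
    rwa [Function.update_of_ne hkj, Function.update_of_ne hki] at this
  have hzi : ‖z i‖ < R i * r := by
    have := hz i
    rwa [Function.update_of_ne hij, Function.update_self] at this
  have hzj : ‖z j‖ < R j * boost t r := by
    have := hz j
    rwa [Function.update_self] at this
  have key := asano_edge_radii ht0 ht1 hr0 hr1 (hR i) (hR j) HF (z i) (z j) hzi hzj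
  have e1 : (∑ σ : ι → Bool, w σ * ∏ k, (if σ k then (1 : ℂ) else z k)) = F (z i) (z j) := by
    simp only [hF, Function.update_eq_self]
  have e2 : (∑ σ : ι → Bool, w σ * ((if σ i then 1 else -1) * (if σ j then 1 else -1)) *
      ∏ k, (if σ k then (1 : ℂ) else z k)) = F (-z i) (-z j) := by
    calc (∑ σ : ι → Bool, w σ * ((if σ i then 1 else -1) * (if σ j then 1 else -1)) *
          ∏ k, (if σ k then (1 : ℂ) else z k))
        = ∑ σ : ι → Bool, w σ * (if σ j then 1 else -1) * (if σ i then 1 else -1) *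
            ∏ k, (if σ k then (1 : ℂ) else z k) := by
          refine Finset.sum_congr rfl fun σ _ => ?_
          ring
      _ = ∑ σ : ι → Bool, w σ * (if σ j then 1 else -1) *
            ∏ k, (if σ k then (1 : ℂ) else Function.update z i (-z i) k) :=
          sum_mul_spin (fun σ => w σ * (if σ j then 1 else -1)) z i
      _ = ∑ σ : ι → Bool, w σ * ∏ k, (if σ k then (1 : ℂ) else
            Function.update (Function.update z i (-z i)) j (-Function.update z i (-z i) j) k) :=
          sum_mul_spin w _ j
      _ = F (-z i) (-z j) := by
          simp only [hF, Function.update_of_ne (Ne.symm hij)]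
  rw [sum_mul_edge, e1, e2, habcd, habcd]
  convert key using 1
  ring

omit [Fintype ι] in
/-- The radius factor an ORIENTED edge `e = (i, j, r)` contributes at the vertex `k`: `r` at its
first end `i` (the end confined to a smaller disc), `boost t r` at its second end `j`, `1` at the
other vertices. [cite: LeeYang1952, Appendix II] -/
def edgeFactor (t : ℝ) (e : ι × ι × ℝ) (k : ι) : ℝ :=
  if k = e.1 then e.2.2 else if k = e.2.1 then boost t e.2.2 else 1

omit [Fintype ι] in
/-- The radii certified for an edge set: `radii t E k = ∏_{e ∈ E} edgeFactor t e k`.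
[cite: LeeYang1952, Appendix II] -/
def radii (t : ℝ) (E : Finset (ι × ι × ℝ)) (k : ι) : ℝ := ∏ e ∈ E, edgeFactor t e k

omit [Fintype ι] [DecidableEq ι] in
/-- The product of the ferromagnetic edge factors `[σ_i = σ_j ? 1 : t]` over an edge set.
[cite: FriedliVelenik2017, §3.7.4, eq. (3.52)] -/
def edgeWeight (t : ℝ) (E : Finset (ι × ι × ℝ)) (σ : ι → Bool) : ℂ :=
  ∏ e ∈ E, (if σ e.1 = σ e.2.1 then 1 else (t : ℂ))

omit [Fintype ι] in
/-- The edge factor is positive (`0 < r ≤ 1`, `t ∈ [0,1]`). [folklore] -/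
theorem edgeFactor_pos {t : ℝ} (ht0 : 0 ≤ t) (ht1 : t ≤ 1) {e : ι × ι × ℝ} (hr0 : 0 < e.2.2)
    (hr1 : e.2.2 ≤ 1) (k : ι) : 0 < edgeFactor t e k := by
  unfold edgeFactor
  split_ifs
  · exact hr0
  · exact boost_pos ht0 ht1 hr0 hr1
  · exact one_pos

omit [Fintype ι] in
/-- The certified radii are positive. [folklore] -/
theorem radii_pos {t : ℝ} (ht0 : 0 ≤ t) (ht1 : t ≤ 1) {E : Finset (ι × ι × ℝ)}
    (hE : ∀ e ∈ E, e.1 ≠ e.2.1 ∧ 0 < e.2.2 ∧ e.2.2 ≤ 1) (k : ι) : 0 < radii t E k :=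
  Finset.prod_pos fun e he => edgeFactor_pos ht0 ht1 (hE e he).2.1 (hE e he).2.2 k

omit [Fintype ι] in
/-- `radii t ∅ = 1`. [folklore] -/
@[simp] theorem radii_empty (t : ℝ) (k : ι) : radii t (∅ : Finset (ι × ι × ℝ)) k = 1 := by
  simp [radii]

omit [Fintype ι] in
/-- Inserting an edge multiplies the radii by its factors. [folklore] -/
theorem radii_insert (t : ℝ) {e : ι × ι × ℝ} {E : Finset (ι × ι × ℝ)} (he : e ∉ E) (k : ι) :
    radii t (insert e E) k = edgeFactor t e k * radii t E k := by
  simp [radii, Finset.prod_insert he]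

omit [Fintype ι] in
/-- **The certified radius at a vertex**: the product of the `r`'s of the edges whose first end is
`k` times the product of the boosts of the edges whose second end is `k`.
[cite: LeeYang1952, Appendix II] -/
theorem radii_eq (t : ℝ) {E : Finset (ι × ι × ℝ)} (hE : ∀ e ∈ E, e.1 ≠ e.2.1) (k : ι) :
    radii t E k = (∏ e ∈ E.filter (fun e => e.1 = k), e.2.2) *
      ∏ e ∈ E.filter (fun e => e.2.1 = k), boost t e.2.2 := by
  unfold radii
  rw [Finset.prod_filter, Finset.prod_filter, ← Finset.prod_mul_distrib]
  refine Finset.prod_congr rfl fun e he => ?_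
  have hne := hE e he
  obtain ⟨i, j, r⟩ := e
  simp only at hne ⊢
  unfold edgeFactor
  simp only
  by_cases hik : k = i
  · subst hik
    simp [Ne.symm hne]
  · by_cases hjk : k = j
    · subst hjk
      simp [hne, Ne.symm hne]
    · simp [hik, hjk, Ne.symm hik, Ne.symm hjk]

/-- **Lee–Yang with radii (Ruelle's theorem for discs).** For `t ∈ [0,1]` and a finite set `E` of
oriented edges `(i, j, r)` with `i ≠ j`, `0 < r ≤ 1`, the multi-affine polynomial
`∑_σ (∏_{e∈E} [σ_i = σ_j ? 1 : t]) ∏ₖ [σₖ ? 1 : zₖ]` has no zero with `‖zₖ‖ < radii t E k` for all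
`k` (induction on `E` from `LeeYangCircle.sum_prod_ite_ne_zero` — the empty edge set, unit radii —
by `zeroFree_mul_edge`). With all `r = 1` this is the classical circle theorem
(`LeeYangCircle.lyProp_prod_edges`); with `r < 1` on chosen ends the zero-free polydisc extends
beyond the unit circle at the other ends. [cite: LeeYang1952, Appendix II] -/
theorem zeroFree_prod_edges {t : ℝ} (ht0 : 0 ≤ t) (ht1 : t ≤ 1) (E : Finset (ι × ι × ℝ))
    (hE : ∀ e ∈ E, e.1 ≠ e.2.1 ∧ 0 < e.2.2 ∧ e.2.2 ≤ 1) :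
    ∀ z : ι → ℂ, (∀ k, ‖z k‖ < radii t E k) →
      (∑ σ : ι → Bool, edgeWeight t E σ * ∏ k, (if σ k then (1 : ℂ) else z k)) ≠ 0 := by
  classical
  induction E using Finset.induction_on with
  | empty =>
    intro z hz
    simpa [edgeWeight] using sum_prod_ite_ne_zero z (fun k => by simpa using hz k)
  | insert e E heE ih =>
    have hE' : ∀ e' ∈ E, e'.1 ≠ e'.2.1 ∧ 0 < e'.2.2 ∧ e'.2.2 ≤ 1 := fun e' he' =>
      hE e' (Finset.mem_insert_of_mem he')
    obtain ⟨hij, hr0, hr1⟩ := hE e (Finset.mem_insert_self e E)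
    have step := zeroFree_mul_edge (radii_pos ht0 ht1 hE') (ih hE') hij ht0 ht1 hr0 hr1
    have hfun : ∀ σ : ι → Bool, edgeWeight t (insert e E) σ =
        edgeWeight t E σ * (if σ e.1 = σ e.2.1 then 1 else (t : ℂ)) := fun σ => by
      rw [edgeWeight, edgeWeight, Finset.prod_insert heE, mul_comm]
    intro z hz
    simp_rw [hfun]
    refine step z fun k => ?_
    have hzk := hz k
    rw [radii_insert t heE] at hzk
    -- the updated radii are `edgeFactor t e k * radii t E k`
    rcases eq_or_ne k e.2.1 with hkj | hkj
    · rw [hkj, Function.update_self]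
      have : edgeFactor t e e.2.1 = boost t e.2.2 := by
        simp [edgeFactor, Ne.symm hij]
      rw [hkj, this, mul_comm] at hzk
      exact hzk
    · rw [Function.update_of_ne hkj]
      rcases eq_or_ne k e.1 with hki | hki
      · rw [hki, Function.update_self]
        have : edgeFactor t e e.1 = e.2.2 := by simp [edgeFactor]
        rw [hki, this, mul_comm] at hzk
        exact hzk
      · rw [Function.update_of_ne hki]
        have : edgeFactor t e k = 1 := by simp [edgeFactor, hki, hkj]
        rw [this, one_mul] at hzk
        exact hzk

end LeeYangRadii

end Literature.Probability.LatticeModels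

end
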